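import Summits.NavierStokesRegularity.NavierStokesRegularity.Theorems.LerayQuarterDissipationFiniteDissipationLiouvilleTraceEpsilon
import Summits.NavierStokesRegularity.NavierStokesRegularity.Theorems.LerayQuarterDissipationFiniteDissipationLiouvilleFarField
import Literature.Analysis.FluidPDE.TypeIAncientMildRescale
import HarnessLib

/-!
# Crux `FiniteDissipationLiouville` (stmt-NavierStokesRegularity-22144): THE FINAL-TIME SINGULAR
# SET OF A MEMBER OF THE STRATUM IS READ OFF ITS FINAL DATUM — `x₀` is singular iff the trace
# `u(0⁻)` is unbounded on every neighbourhood of `x₀`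

Theorems file of route `LerayQuarterDissipation` (lead prover g5; `--supports` the crux: a
structure theorem for EVERY member of the stratum, bearing on both registered stubs of the line
`birth`). Navier–Stokes regularity is NOT proved by anything here; no summit is.

`𝒟_{C,K}`: Type-I ancient mild fields `u` (`IsTypeIAncientMild C u`) with the quarter-rate law;
`T_u(ψ) = lim_{t→0⁻} ∫⟪u(t), ψ⟫` the distributional trace (lead g3). A point `x₀` is a (final-time)
SINGULAR POINT of `u` when `u` is unbounded on every backward cylinder `(−ρ², 0) × B(x₀, ρ)` (the
crux's clause, centred at `x₀`; lead g4 proved that there are at most `c(K⁺)³` of them,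
`exists_finite_singularSet`, and that the trace is a bounded function away from them,
`trace_bounded_off_singularSet`). The apex leaves of `…TraceApex` / `…TraceEpsilon` (this lead)
were stated at the origin; the class, the law and the trace are TRANSLATION COVARIANT
(`IsTypeIAncientMild.comp_add_right`, Literature, this lead), so they hold at every point:

* `dissipationLaw_comp_add_right`, `singularAt_iff_singular_translate`,
  `integral_pairing_comp_add_right` — translation covariance of the law, of the singular clause
  and of the pairings (`T_{u(·+a)}(ψ) = T_u(ψ(· − a))`).
* `not_singularAt_of_trace_locallyBounded_at` — **at ANY point `a`: if the trace is a bounded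
  function near `a` (`|T_u(ψ)| ≤ M∫‖ψ‖` for test fields supported in `B(a, r₀)`), then `a` is not a
  singular point.**
* `exists_trace_epsilon_at` — **the one-scale ε-regularity criterion at every point with the SAME
  threshold `ε₀(C,K)`**: dual-`L³` mass of the trace `≤ ε₀` on ONE ball `B(a, ρ)` ⇒ `a` regular.
* `trace_locallyBounded_of_not_singularAt` — conversely, near a REGULAR point the trace IS a
  bounded function (lead g4's `trace_bounded_off_singularSet` + finiteness of the singular set:
  a regular point is at positive distance from the singular ones).
* `singularAt_iff_trace_unbounded_near` — **THE CHARACTERISATION: for `u ∈ 𝒟_{C,K}` and every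
  point `a`, `a` is a final-time singular point of `u` IFF the final datum `u(0⁻)` is unbounded on
  every neighbourhood of `a`** (for all `ρ, M` some test field supported in `B(a, ρ)` has
  `|T_u(ψ)| > M ∫‖ψ‖`). So the final-time singular set of a Type-I dissipation-law profile — at
  most `c(K⁺)³` points — IS the `L^∞`-singular support of its final datum: **on `𝒟` every
  singularity is visible in the final datum, pointwise, and nothing else is** (the datum is a
  bounded function exactly off the singular set). For the stubs: a counterexample to either stub is
  a member whose final datum `u₀ ∈ M^{2,1}(ℝ³)` has a NONEMPTY, finite `L^∞`-singular support
  containing the apex, with dual-`L³` mass `≥ ε₀(C,K)` at every scale around each of its points and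
  `≥ ε₁(C,K)` outside every ball (`…TraceEpsilon`).

References: Caffarelli–Kohn–Nirenberg, CPAM 35 (1982); Koch–Nadirashvili–Seregin–Šverák, Acta
Math. 203 (2009), §1 (symmetries), §4; Albritton–Barker, arXiv:1811.00502, Prop. 2.3;
Lemarié-Rieusset (2016), Thm. 15.4.
-/

noncomputable section

-- the summit and its single sub-problem share the name (CONVENTIONS §1), as in every Theorems file
set_option linter.dupNamespace false

namespace Summit.NavierStokesRegularity.NavierStokesRegularity.Theorems.FiniteDissipationLiouville.Birth.Apex

open MeasureTheory Set Filter Topology Metric Function TopologicalSpace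
open Literature.Analysis Literature.Analysis.FluidPDE
open scoped ENNReal NNReal RealInnerProductSpace

variable {C K : ℝ} {u : ℝ → EuclideanSpace ℝ (Fin 3) → EuclideanSpace ℝ (Fin 3)}

/-! ### Translation covariance of the law, the singular clause and the pairings -/

/-- **The quarter-rate law is translation invariant**: `u(·, · + a)` obeys it with the same `K`. -/
theorem dissipationLaw_comp_add_right
    (hlaw : ∀ s : ℝ, s < 0 → ∫⁻ x, ‖fderiv ℝ (u s) x‖ₑ ^ 2 ≤ ENNReal.ofReal (K / Real.sqrt (-s)))
    (a : EuclideanSpace ℝ (Fin 3)) :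
    ∀ s : ℝ, s < 0 →
      ∫⁻ x, ‖fderiv ℝ ((fun t x => u t (x + a)) s) x‖ₑ ^ 2 ≤ ENNReal.ofReal (K / Real.sqrt (-s)) := by
  intro s hs
  have e : (fun x => ‖fderiv ℝ ((fun t x => u t (x + a)) s) x‖ₑ ^ 2) =
      fun x => (fun y => ‖fderiv ℝ (u s) y‖ₑ ^ 2) (x + a) := by
    funext x
    simp only [fderiv_comp_add_right]
  rw [e, lintegral_add_right_eq_self (fun y => ‖fderiv ℝ (u s) y‖ₑ ^ 2) a]
  exact hlaw s hs

/-- **The singular clause at `a` is the singular clause at the origin for the translate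
`u(·, · + a)`.** -/
theorem singularAt_iff_singular_translate (a : EuclideanSpace ℝ (Fin 3)) :
    (∀ ρ > 0, ∀ M : ℝ, ∃ t ∈ Ioo (-(ρ ^ 2)) (0 : ℝ), ∃ x ∈ ball a ρ, M < ‖u t x‖) ↔
      (∀ ρ > 0, ∀ M : ℝ, ∃ t ∈ Ioo (-(ρ ^ 2)) (0 : ℝ),
        ∃ x ∈ ball (0 : EuclideanSpace ℝ (Fin 3)) ρ, M < ‖(fun t x => u t (x + a)) t x‖) := by
  constructor
  · intro h ρ hρ M
    obtain ⟨t, ht, x, hx, hM⟩ := h ρ hρ M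
    refine ⟨t, ht, x - a, ?_, ?_⟩
    · rwa [mem_ball_zero_iff, ← dist_eq_norm, ← mem_ball]
    · simp only [sub_add_cancel]
      exact hM
  · intro h ρ hρ M
    obtain ⟨t, ht, x, hx, hM⟩ := h ρ hρ M
    refine ⟨t, ht, x + a, ?_, hM⟩
    rw [mem_ball, dist_eq_norm, add_sub_cancel_right]
    exact mem_ball_zero_iff.1 hx

/-- **Pairings of the translate**: `∫⟪u(t, x + a), ψ(x)⟫ dx = ∫⟪u(t, y), ψ(y − a)⟫ dy`. -/
theorem integral_pairing_comp_add_right (t : ℝ) (ψ : EuclideanSpace ℝ (Fin 3) → EuclideanSpace ℝ (Fin 3))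
    (a : EuclideanSpace ℝ (Fin 3)) :
    ∫ x, ⟪u t (x + a), ψ x⟫ = ∫ y, ⟪u t y, ψ (y - a)⟫ := by
  have h := integral_add_right_eq_self (μ := (volume : Measure (EuclideanSpace ℝ (Fin 3))))
    (fun y => ⟪u t y, ψ (y - a)⟫) a
  simp only [add_sub_cancel_right] at h
  exact h

/-- The translate `ψ(· − a)` of a test field is a test field, supported in `B(a, r)` when `ψ` is
supported in `B(0, r)`, with the same `L¹` and `L^{3/2}` masses. -/
theorem isTestFunctionOn_comp_sub {ψ : EuclideanSpace ℝ (Fin 3) → EuclideanSpace ℝ (Fin 3)}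
    (hψ : FunctionSpaces.IsTestFunctionOn (⊤ : Opens (EuclideanSpace ℝ (Fin 3))) ψ)
    (a : EuclideanSpace ℝ (Fin 3)) :
    FunctionSpaces.IsTestFunctionOn (⊤ : Opens (EuclideanSpace ℝ (Fin 3))) (fun y => ψ (y - a)) :=
  { contDiff := hψ.contDiff.comp (contDiff_id.sub contDiff_const)
    hasCompactSupport := hψ.hasCompactSupport.comp_homeomorph (Homeomorph.subRight a)
    tsupport_subset := fun y _ => Opens.mem_top y }

/-! ### The apex leaves at an arbitrary point -/

/-- **A bounded trace near ANY point `a` makes `a` regular.** If `u ∈ 𝒟_{C,K}` and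
`|T_u(ψ)| ≤ M ∫‖ψ‖` for all test fields `ψ` supported in `B(a, r₀)`, then `a` is not a final-time
singular point of `u` (translate of `not_singular_of_trace_locallyBounded`). -/
theorem not_singularAt_of_trace_locallyBounded_at (hu : IsTypeIAncientMild C u)
    (hlaw : ∀ s : ℝ, s < 0 → ∫⁻ x, ‖fderiv ℝ (u s) x‖ₑ ^ 2 ≤ ENNReal.ofReal (K / Real.sqrt (-s)))
    (a : EuclideanSpace ℝ (Fin 3)) {r₀ M : ℝ} (hr₀ : 0 < r₀)
    (hbd : ∀ ψ : EuclideanSpace ℝ (Fin 3) → EuclideanSpace ℝ (Fin 3),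
      FunctionSpaces.IsTestFunctionOn (⊤ : Opens (EuclideanSpace ℝ (Fin 3))) ψ →
      (∀ x, ψ x ≠ 0 → ‖x - a‖ < r₀) →
      ∀ T : ℝ, Tendsto (fun t => ∫ x, ⟪u t x, ψ x⟫) (𝓝[<] 0) (𝓝 T) → |T| ≤ M * ∫ x, ‖ψ x‖) :
    ¬ (∀ ρ > 0, ∀ M' : ℝ, ∃ t ∈ Ioo (-(ρ ^ 2)) (0 : ℝ), ∃ x ∈ ball a ρ, M' < ‖u t x‖) := by
  rw [singularAt_iff_singular_translate a]
  refine not_singular_of_trace_locallyBounded (hu.comp_add_right a) (dissipationLaw_comp_add_right hlaw a)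
    hr₀ (M := M) fun ψ hψ hsupp T hT => ?_
  -- the pairings of the translate are the pairings of `u` with `ψ(· − a)`
  have hT' : Tendsto (fun t => ∫ y, ⟪u t y, ψ (y - a)⟫) (𝓝[<] 0) (𝓝 T) := by
    refine hT.congr fun t => ?_
    exact integral_pairing_comp_add_right t ψ a
  have hsupp' : ∀ y, ψ (y - a) ≠ 0 → ‖y - a‖ < r₀ := fun y hy => hsupp _ hy
  have h := hbd _ (isTestFunctionOn_comp_sub hψ a) hsupp' T hT'
  rwa [integral_sub_right_eq_self (fun y => ‖ψ y‖) a] at h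

/-- **The one-scale ε-regularity criterion in terms of the final datum, at every point, with the
same threshold `ε₀(C,K)`.** There is `ε₀ > 0` such that for every `u ∈ 𝒟_{C,K}`, every point `a`
and SOME `ρ > 0`: `|T_u(ψ)| ≤ ε₀ ‖ψ‖_{L^{3/2}}` for all test fields supported in `B(a, ρ)` implies
that `a` is regular. -/
theorem exists_trace_epsilon_at (C K : ℝ) : ∃ ε₀ > 0,
    ∀ (u : ℝ → EuclideanSpace ℝ (Fin 3) → EuclideanSpace ℝ (Fin 3)),
      IsTypeIAncientMild C u →
      (∀ s : ℝ, s < 0 → ∫⁻ x, ‖fderiv ℝ (u s) x‖ₑ ^ 2 ≤ ENNReal.ofReal (K / Real.sqrt (-s))) →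
      ∀ (a : EuclideanSpace ℝ (Fin 3)), ∀ ρ > 0,
      (∀ ψ : EuclideanSpace ℝ (Fin 3) → EuclideanSpace ℝ (Fin 3),
        FunctionSpaces.IsTestFunctionOn (⊤ : Opens (EuclideanSpace ℝ (Fin 3))) ψ →
        (∀ x, ψ x ≠ 0 → ‖x - a‖ < ρ) →
        ∀ T : ℝ, Tendsto (fun t => ∫ x, ⟪u t x, ψ x⟫) (𝓝[<] 0) (𝓝 T) →
          |T| ≤ ε₀ * (∫ x, ‖ψ x‖ ^ (3 / 2 : ℝ)) ^ (2 / 3 : ℝ)) →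
      ¬ (∀ ρ' > 0, ∀ M : ℝ, ∃ t ∈ Ioo (-(ρ' ^ 2)) (0 : ℝ), ∃ x ∈ ball a ρ', M < ‖u t x‖) := by
  obtain ⟨ε₀, hε₀, h⟩ := exists_trace_epsilon_apex C K
  refine ⟨ε₀, hε₀, fun u hu hlaw a ρ hρ hsmall => ?_⟩
  rw [singularAt_iff_singular_translate a]
  refine h _ (hu.comp_add_right a) (dissipationLaw_comp_add_right hlaw a) ρ hρ
    fun ψ hψ hsupp T hT => ?_
  have hT' : Tendsto (fun t => ∫ y, ⟪u t y, ψ (y - a)⟫) (𝓝[<] 0) (𝓝 T) := by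
    refine hT.congr fun t => ?_
    exact integral_pairing_comp_add_right t ψ a
  have hsupp' : ∀ y, ψ (y - a) ≠ 0 → ‖y - a‖ < ρ := fun y hy => hsupp _ hy
  have h1 := hsmall _ (isTestFunctionOn_comp_sub hψ a) hsupp' T hT'
  rwa [integral_sub_right_eq_self (fun y => ‖ψ y‖ ^ (3 / 2 : ℝ)) a] at h1

/-! ### Near a regular point the trace is a bounded function -/

/-- **Near a REGULAR point the trace is a bounded function** (lead g4's
`trace_bounded_off_singularSet` and the finiteness of the singular set: a regular point is at
positive distance from the finitely many singular ones). -/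
theorem trace_locallyBounded_of_not_singularAt (hu : IsTypeIAncientMild C u)
    (hlaw : ∀ s : ℝ, s < 0 → ∫⁻ x, ‖fderiv ℝ (u s) x‖ₑ ^ 2 ≤ ENNReal.ofReal (K / Real.sqrt (-s)))
    {a : EuclideanSpace ℝ (Fin 3)}
    (ha : ¬ (∀ ρ > 0, ∀ M : ℝ, ∃ t ∈ Ioo (-(ρ ^ 2)) (0 : ℝ), ∃ x ∈ ball a ρ, M < ‖u t x‖)) :
    ∃ r₀ M : ℝ, 0 < r₀ ∧ ∀ ψ : EuclideanSpace ℝ (Fin 3) → EuclideanSpace ℝ (Fin 3),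
      FunctionSpaces.IsTestFunctionOn (⊤ : Opens (EuclideanSpace ℝ (Fin 3))) ψ →
      (∀ x, ψ x ≠ 0 → ‖x - a‖ < r₀) →
      ∀ T : ℝ, Tendsto (fun t => ∫ x, ⟪u t x, ψ x⟫) (𝓝[<] 0) (𝓝 T) → |T| ≤ M * ∫ x, ‖ψ x‖ := by
  -- the singular set is finite, hence closed, and `a` lies outside it
  obtain ⟨c, -, hfin⟩ := exists_finite_singularSet
  obtain ⟨hSf, -⟩ := hfin C K u hu hlaw
  set S : Set (EuclideanSpace ℝ (Fin 3)) := {x₀ : EuclideanSpace ℝ (Fin 3) | ∀ ρ > 0, ∀ M : ℝ,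
    ∃ t ∈ Ioo (-(ρ ^ 2)) (0 : ℝ), ∃ x ∈ ball x₀ ρ, M < ‖u t x‖} with hS
  have haS : a ∈ Sᶜ := ha
  obtain ⟨δ₀, hδ₀, hball⟩ := Metric.isOpen_iff.1 hSf.isClosed.isOpen_compl a haS
  -- test fields supported in `B(a, δ₀/2)` stay `δ₀/2`-away from every singular point
  obtain ⟨M, hM⟩ := trace_bounded_off_singularSet hu hlaw (half_pos hδ₀)
  refine ⟨δ₀ / 2, M, half_pos hδ₀, fun ψ hψ hsupp T hT => hM ψ hψ (fun x hx s hs => ?_) T hT⟩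
  have hxa : ‖x - a‖ < δ₀ / 2 := hsupp x hx
  have hsa : δ₀ ≤ dist s a := by
    by_contra hlt
    push Not at hlt
    exact hball (mem_ball.2 hlt) hs
  rw [← dist_eq_norm] at hxa
  have htri : dist s a ≤ dist s x + dist x a := dist_triangle s x a
  rw [dist_comm s x] at htri
  linarith

/-! ### The characterisation of the singular set by the final datum -/

/-- **THE FINAL-TIME SINGULAR SET IS READ OFF THE FINAL DATUM.** For `u ∈ 𝒟_{C,K}` and every point
`a`: `a` is a final-time singular point of `u` — `u` is unbounded on every backward cylinder
`(−ρ², 0) × B(a, ρ)` — IF AND ONLY IF the distributional trace `u(0⁻)` is unbounded on every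
neighbourhood of `a`: for all `ρ > 0` and `M`, some test field `ψ` supported in `B(a, ρ)` has
`|T_u(ψ)| > M ∫‖ψ‖`. -/
theorem singularAt_iff_trace_unbounded_near (hu : IsTypeIAncientMild C u)
    (hlaw : ∀ s : ℝ, s < 0 → ∫⁻ x, ‖fderiv ℝ (u s) x‖ₑ ^ 2 ≤ ENNReal.ofReal (K / Real.sqrt (-s)))
    (a : EuclideanSpace ℝ (Fin 3)) :
    (∀ ρ > 0, ∀ M : ℝ, ∃ t ∈ Ioo (-(ρ ^ 2)) (0 : ℝ), ∃ x ∈ ball a ρ, M < ‖u t x‖) ↔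
      ∀ ρ > 0, ∀ M : ℝ, ∃ (ψ : EuclideanSpace ℝ (Fin 3) → EuclideanSpace ℝ (Fin 3)) (T : ℝ),
        FunctionSpaces.IsTestFunctionOn (⊤ : Opens (EuclideanSpace ℝ (Fin 3))) ψ ∧
          (∀ x, ψ x ≠ 0 → ‖x - a‖ < ρ) ∧
          Tendsto (fun t => ∫ x, ⟪u t x, ψ x⟫) (𝓝[<] 0) (𝓝 T) ∧ M * ∫ x, ‖ψ x‖ < |T| := by
  constructor
  · intro hsing ρ hρ M
    by_contra hno
    push Not at hno
    exact not_singularAt_of_trace_locallyBounded_at hu hlaw a hρ (M := M)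
      (fun ψ hψ hs T hT => hno ψ T hψ hs hT) hsing
  · intro h
    by_contra hreg
    obtain ⟨r₀, M, hr₀, hM⟩ := trace_locallyBounded_of_not_singularAt hu hlaw hreg
    obtain ⟨ψ, T, hψ, hs, hT, hlt⟩ := h r₀ hr₀ M
    exact absurd (hM ψ hψ hs T hT) (not_le.2 hlt)

/-- **PORTRAIT ENTRY (both stubs): at EVERY final-time singular point the final datum carries
dual-`L³` mass `> ε₀(C,K)` in every ball** (the uniform apex floor of `…TraceEpsilon`,
transported to each of the at most `c(K⁺)³` singular points). -/
theorem trace_L3_floor_at_singular (C K : ℝ) : ∃ ε₀ > 0,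
    ∀ (u : ℝ → EuclideanSpace ℝ (Fin 3) → EuclideanSpace ℝ (Fin 3)),
      IsTypeIAncientMild C u →
      (∀ s : ℝ, s < 0 → ∫⁻ x, ‖fderiv ℝ (u s) x‖ₑ ^ 2 ≤ ENNReal.ofReal (K / Real.sqrt (-s))) →
      ∀ (a : EuclideanSpace ℝ (Fin 3)),
      (∀ ρ > 0, ∀ M : ℝ, ∃ t ∈ Ioo (-(ρ ^ 2)) (0 : ℝ), ∃ x ∈ ball a ρ, M < ‖u t x‖) →
      ∀ ρ > 0, ∃ (ψ : EuclideanSpace ℝ (Fin 3) → EuclideanSpace ℝ (Fin 3)) (T : ℝ),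
        FunctionSpaces.IsTestFunctionOn (⊤ : Opens (EuclideanSpace ℝ (Fin 3))) ψ ∧
          (∀ x, ψ x ≠ 0 → ‖x - a‖ < ρ) ∧
          Tendsto (fun t => ∫ x, ⟪u t x, ψ x⟫) (𝓝[<] 0) (𝓝 T) ∧
          ε₀ * (∫ x, ‖ψ x‖ ^ (3 / 2 : ℝ)) ^ (2 / 3 : ℝ) < |T| := by
  obtain ⟨ε₀, hε₀, h⟩ := exists_trace_epsilon_at C K
  refine ⟨ε₀, hε₀, fun u hu hlaw a hsing ρ hρ => ?_⟩
  by_contra hno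
  push Not at hno
  exact h u hu hlaw a ρ hρ (fun ψ hψ hs T hT => hno ψ T hψ hs hT) hsing

end Summit.NavierStokesRegularity.NavierStokesRegularity.Theorems.FiniteDissipationLiouville.Birth.Apex

end
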